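import Literature.NumberTheory.LFunctions.DirichletLRiemannHypothesisUpTo
import Literature.NumberTheory.LFunctions.WeilExplicitDirichlet
import HarnessLib

/-!
# Explicit zero counting for Dirichlet `L`-functions: Bennett–Martin–O'Bryant–Rechnitzer, Theorem 1.1

Topic `Literature/NumberTheory/LFunctions`; namespace `Literature.NumberTheory.LFunctions`. Companion of
`DirichletLRiemannHypothesisUpTo.lean` (which fixes `N(T, χ) = lfunctionZeroCount χ T`, the number of zeros
`ρ = β + iγ` of `L(s, χ)` with `0 < β < 1` and `|γ| ≤ T`, counted with multiplicity — exactly the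
`N(T, χ)` of Bennett–Martin–O'Bryant–Rechnitzer, §1: "`N(T, χ) := #{ρ ∈ Z(χ) : |γ| ≤ T}`, counted with
multiplicity", `Z(χ) = {ρ : 0 < β < 1, L(ρ, χ) = 0}` ((1.2)) — and carries the same paper's Lemma 6.1 (a)
and Platt's Theorem 7.1 as named facts) and of `ZetaZeroCountExplicit.lean` (the `ζ` analogue of
Hasanalizade–Shen–Wong).

## Contents

* `bmorEll q T = log (q(T+2)/(2π))` — the paper's `ℓ`.
* `bmor2021_theorem11` — **Theorem 1.1 AS PRINTED**, a named fact (D-0014), not discharged: for a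
  character of conductor `q > 1` and `T ≥ 5/7`, `N(T, χ) = 0` if `ℓ ≤ 1.567`, and otherwise
  `|N(T, χ) − ((T/π) log(qT/(2πe)) − χ(−1)/4)| ≤ 0.22737 ℓ + 2 log(1 + ℓ) − 0.5`. "A character with
  conductor `q`" is typed, as for `bmor2021_lemma61a`, as a primitive character modulo `q`; `χ(−1) = (−1)^κ`
  with `κ = charParity χ` (`apply_neg_one_eq_pow_charParity`). The printed proof (§§2–6: Backlund's trick,
  Jensen's formula on discs, a Rademacher-type bound for `|L(s, χ)|` on all of `σ < −1/2` (Thm 5.7),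
  Stirling with explicit constants, a numerical optimisation of the resulting integrals, and an `Arb`
  computation of 806 544 low zeros for `1 < q < 935`, §6.3) is size XL and is not reproduced.
* PROVED from the named fact (theorems): the two one-sided forms `main − err ≤ N(T, χ) ≤ main + err`;
  the value `ℓ(q, 1) = log q + log 3 − log 2 − log π`; and the paper's remark (p. 3, after Conjecture 1.3)
  **"Theorem 1.1 implies that `N(1, χ) ≥ 1` when `q ≥ 1.3 × 10⁴⁷`"** in the form
  `one_le_lfunctionZeroCount_one_of_bmor` (`log q ≥ 115`) /
  `exists_lfunctionZero_abs_im_le_one_of_bmor` (`q ≥ 10⁵⁰`): every primitive `χ` of conductor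
  `q ≥ 10⁵⁰` has, unconditionally, a zero `ρ` of `L(s, χ)` with `0 < Re ρ < 1` and `|Im ρ| ≤ 1`.
  The printed threshold `1.3 × 10⁴⁷` is the two-digit rounding of the exact crossing of the
  inequality (margin `2·10⁻³` zeros at `q = 1.3 × 10⁴⁷`); the threshold proved here, `q ≥ 10⁵⁰`
  (`log q ≥ 115`, margin `0.34`), is what four-digit bounds for `π`, `log π` and `log 115` (with Mathlib's nine-digit `log 2`,
  `log 3`, `log 5`) give by hand (`linarith`); nothing finer is attempted.

What is NOT here: Corollary 1.2 (the `(C₁, C₂)` pairs `(0.247, 6.894)`, `(0.298, 4.358)`, a calculus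
exercise on Theorem 1.1 per the paper), Conjectures 1.3/1.4, Theorem 1.5 (small `q`, `T`), and any
discharge of Theorem 1.1.

## References

* M. A. Bennett, G. Martin, K. O'Bryant, A. Rechnitzer, *Counting zeros of Dirichlet `L`-functions*,
  Math. Comp. 90 (2021), no. 329, 1455–1482, doi:10.1090/mcom/3599 = arXiv:2005.02989 (v1, the only
  arXiv version), Theorem 1.1 (p. 2) and the remark on p. 3. [BennettMartinOBryantRechnitzer2021]
* T. Zhao, *The positivity technique and low-lying zeros of Dirichlet `L`-functions*, J. Number Theory
  (2026) = arXiv:2503.15832, §6 Theorem 15 (quotes Theorem 1.1 verbatim from the published version;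
  "`N(1, χ) ≥ 1`, or `|γ_χ| ≤ 1`, when `q ≥ 1.3 × 10⁴⁷`"). (Secondary source; not a bib key here.)
-/

noncomputable section

open Real Set

namespace Literature.NumberTheory.LFunctions

variable {q : ℕ} [NeZero q]

/-! ### The statement AS PRINTED -/

/-- Bennett–Martin–O'Bryant–Rechnitzer's `ℓ := log (q(T + 2)/(2π))` (Theorem 1.1, p. 2), for a conductor
`q` and a height `T`. [cite: BennettMartinOBryantRechnitzer2021, Theorem 1.1] -/
def bmorEll (q : ℕ) (T : ℝ) : ℝ :=
  Real.log (q * (T + 2) / (2 * π))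

/-- **Bennett–Martin–O'Bryant–Rechnitzer 2021, Theorem 1.1 (as printed): "Let `χ` be a character with
conductor `q > 1` and let `T ≥ 5/7`. Set `ℓ := log (q(T+2)/(2π))`. If `ℓ ≤ 1.567`, then `N(T, χ) = 0`. If
`ℓ > 1.567`, then
`|N(T, χ) − ((T/π) log (qT/(2πe)) − χ(−1)/4)| ≤ 0.22737 ℓ + 2 log(1 + ℓ) − 0.5`."**
Here `N(T, χ) = lfunctionZeroCount χ T` (zeros with `0 < β < 1`, `|γ| ≤ T`, with multiplicity — the
paper's (1.2) and definition of `N(T, χ)`, p. 2), the character of conductor `q` is a primitive character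
modulo `q` (as in `bmor2021_lemma61a`), and `χ(−1) = (−1)^{charParity χ}`
(`apply_neg_one_eq_pow_charParity`). Proof in print: §§2–6 (Backlund–Jensen with explicit Stirling and
Rademacher-type bounds, plus a rigorous computation of the zeros with `ℓ ≤ 6`, `1 < q < 935`); size XL,
not discharged here. [cite: BennettMartinOBryantRechnitzer2021, Theorem 1.1] -/
def bmor2021_theorem11 : Prop :=
  ∀ (q : ℕ) [NeZero q], 1 < q → ∀ χ : DirichletCharacter ℂ q, χ.IsPrimitive →
    ∀ T : ℝ, 5 / 7 ≤ T →
      (bmorEll q T ≤ 1.567 → lfunctionZeroCount χ T = 0) ∧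
      (1.567 < bmorEll q T →
        |(lfunctionZeroCount χ T : ℝ) -
            (T / π * Real.log (q * T / (2 * π * Real.exp 1)) - (-1) ^ charParity χ / 4)| ≤
          0.22737 * bmorEll q T + 2 * Real.log (1 + bmorEll q T) - 0.5)

/-! ### One-sided forms -/

variable {χ : DirichletCharacter ℂ q}

/-- Lower form of Theorem 1.1: `(T/π) log(qT/(2πe)) − χ(−1)/4 − (0.22737 ℓ + 2 log(1+ℓ) − 0.5) ≤ N(T, χ)`
for `q > 1`, `χ` primitive, `T ≥ 5/7`, `ℓ > 1.567`. [cite: BennettMartinOBryantRechnitzer2021, Theorem 1.1] -/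
theorem bmor2021_theorem11.main_sub_err_le (h : bmor2021_theorem11) (hq : 1 < q) (hχ : χ.IsPrimitive)
    {T : ℝ} (hT : 5 / 7 ≤ T) (hℓ : 1.567 < bmorEll q T) :
    T / π * Real.log (q * T / (2 * π * Real.exp 1)) - (-1) ^ charParity χ / 4 -
        (0.22737 * bmorEll q T + 2 * Real.log (1 + bmorEll q T) - 0.5) ≤
      (lfunctionZeroCount χ T : ℝ) := by
  have h' := abs_le.1 (((h q hq χ hχ T hT).2) hℓ)
  linarith [h'.1]

/-- Upper form of Theorem 1.1: `N(T, χ) ≤ (T/π) log(qT/(2πe)) − χ(−1)/4 + 0.22737 ℓ + 2 log(1+ℓ) − 0.5`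
for `q > 1`, `χ` primitive, `T ≥ 5/7`, `ℓ > 1.567`. [cite: BennettMartinOBryantRechnitzer2021, Theorem 1.1] -/
theorem bmor2021_theorem11.le_main_add_err (h : bmor2021_theorem11) (hq : 1 < q) (hχ : χ.IsPrimitive)
    {T : ℝ} (hT : 5 / 7 ≤ T) (hℓ : 1.567 < bmorEll q T) :
    (lfunctionZeroCount χ T : ℝ) ≤
      T / π * Real.log (q * T / (2 * π * Real.exp 1)) - (-1) ^ charParity χ / 4 +
        (0.22737 * bmorEll q T + 2 * Real.log (1 + bmorEll q T) - 0.5) := by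
  have h' := abs_le.1 (((h q hq χ hχ T hT).2) hℓ)
  linarith [h'.2]

/-! ### Numerical constants (four digits suffice; `log 2`, `log 3`, `log 5` are Mathlib's) -/

/-- `log π < 1.1457` (`π < 3.141593 < e · 1.1563 ≤ e · e^{0.1457}`). [folklore] -/
private theorem bmor_log_pi_lt : Real.log π < 1.1457 := by
  rw [Real.log_lt_iff_lt_exp Real.pi_pos]
  have h1 : (1.1563 : ℝ) ≤ Real.exp 0.1457 := by
    have := Real.quadratic_le_exp_of_nonneg (show (0 : ℝ) ≤ 0.1457 by norm_num)
    nlinarith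
  have h2 : Real.exp (1.1457 : ℝ) = Real.exp 1 * Real.exp 0.1457 := by
    rw [← Real.exp_add]; norm_num
  calc π < 3.141593 := Real.pi_lt_d6
    _ < 2.7182818283 * 1.1563 := by norm_num
    _ ≤ Real.exp 1 * Real.exp 0.1457 :=
        mul_le_mul Real.exp_one_gt_d9.le h1 (by norm_num) (Real.exp_pos 1).le
    _ = Real.exp 1.1457 := h2.symm

/-- `log 115 < 4.8` (`115 < 2.7182818283⁴ · 2.12 ≤ e⁴ · e^{0.8}`). [folklore] -/
private theorem bmor_log_115_lt : Real.log 115 < 4.8 := by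
  rw [Real.log_lt_iff_lt_exp (by norm_num)]
  have h1 : (2.12 : ℝ) ≤ Real.exp 0.8 := by
    have := Real.quadratic_le_exp_of_nonneg (show (0 : ℝ) ≤ 0.8 by norm_num)
    nlinarith
  have h4 : (2.7182818283 : ℝ) ^ 4 ≤ Real.exp 4 := by
    have : Real.exp 4 = Real.exp 1 ^ 4 := by
      rw [← Real.exp_nat_mul]; norm_num
    rw [this]
    exact pow_le_pow_left₀ (by norm_num) Real.exp_one_gt_d9.le 4
  have h2 : Real.exp (4.8 : ℝ) = Real.exp 4 * Real.exp 0.8 := by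
    rw [← Real.exp_add]; norm_num
  calc (115 : ℝ) < 2.7182818283 ^ 4 * 2.12 := by norm_num
    _ ≤ Real.exp 4 * Real.exp 0.8 := mul_le_mul h4 h1 (by norm_num) (Real.exp_pos 4).le
    _ = Real.exp 4.8 := h2.symm

/-- `2.3 ≤ log 10` (`log 10 = log 2 + log 5` with Mathlib's nine-digit values). [folklore] -/
private theorem bmor_log_ten_ge : (2.3 : ℝ) ≤ Real.log 10 := by
  rw [Real.log_ten_eq]
  linarith [Real.log_two_gt_d9, Real.log_five_gt_d9]

/-- `(−1)^κ / 4 ≤ 1/4` for a natural number `κ` (the offset `χ(−1)/4` is `±1/4`). [folklore] -/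
private theorem bmor_neg_one_pow_div_four_le (κ : ℕ) : (-1 : ℝ) ^ κ / 4 ≤ 1 / 4 := by
  rcases neg_one_pow_eq_or ℝ κ with h | h <;> norm_num [h]

/-! ### `ℓ` and the main term at `T = 1` -/

omit [NeZero q] in
/-- At `T = 1`: `ℓ(q, 1) = log(3q/(2π)) = log q + log 3 − log 2 − log π` (`q ≥ 1`).
[cite: BennettMartinOBryantRechnitzer2021, Theorem 1.1] -/
theorem bmorEll_one (hq : 0 < q) :
    bmorEll q 1 = Real.log q + Real.log 3 - Real.log 2 - Real.log π := by
  have hq' : (0 : ℝ) < q := by exact_mod_cast hq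
  unfold bmorEll
  rw [show ((q : ℝ) * (1 + 2) / (2 * π)) = (q * 3) / (2 * π) by ring,
    Real.log_div (by positivity) (by positivity), Real.log_mul hq'.ne' (by norm_num),
    Real.log_mul (by norm_num) Real.pi_pos.ne']
  ring

omit [NeZero q] in
/-- At `T = 1` the logarithm in the main term is `log(q/(2πe)) = log q − log 2 − log π − 1` (`q ≥ 1`).
[cite: BennettMartinOBryantRechnitzer2021, Theorem 1.1] -/
theorem bmor_log_mainTerm_one (hq : 0 < q) :
    Real.log (q * 1 / (2 * π * Real.exp 1)) = Real.log q - Real.log 2 - Real.log π - 1 := by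
  have hq' : (0 : ℝ) < q := by exact_mod_cast hq
  rw [mul_one, Real.log_div hq'.ne' (by positivity), Real.log_mul (by positivity) (Real.exp_pos 1).ne',
    Real.log_mul (by norm_num) Real.pi_pos.ne', Real.log_exp]
  ring

/-! ### The printed consequence: `N(1, χ) ≥ 1` for every large conductor -/

/-- **"Theorem 1.1 implies that `N(1, χ) ≥ 1` when `q ≥ 1.3 × 10⁴⁷`"** (Bennett–Martin–O'Bryant–Rechnitzer,
p. 3), proved from the named fact for `log q ≥ 115` (i.e. `q ≥ e¹¹⁵ ≈ 8.8 × 10⁴⁹`; the printed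
threshold is the exact crossing to two digits, margin `0.002` zeros, and is not reproduced with the
four-digit constants used here). Proof: at `T = 1`, `ℓ = log q + log 3 − log 2π ≥ 114`, the main term is
`(ℓ − log 3 − 1)/π − χ(−1)/4 ≥ 0.3183 (ℓ − 2.099) − 1/4`, and by concavity
`2 log(1 + ℓ) ≤ 2 log 115 + 2(ℓ − 114)/115 < 9.6 + 2(ℓ − 114)/115`; the difference main − error is
increasing in `ℓ` (slope `1/π − 0.22737 − 2/115 > 0.07`) and equals `0.34… > 0` at `ℓ = 114`, so
`N(1, χ) > 0`. [cite: BennettMartinOBryantRechnitzer2021, Theorem 1.1 and p. 3] -/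
theorem one_le_lfunctionZeroCount_one_of_bmor (h : bmor2021_theorem11) (hq : (115 : ℝ) ≤ Real.log q)
    (χ : DirichletCharacter ℂ q) (hχ : χ.IsPrimitive) : 1 ≤ lfunctionZeroCount χ 1 := by
  have hq0 : 0 < q := Nat.pos_of_ne_zero (NeZero.ne q)
  have hq0' : (0 : ℝ) < q := by exact_mod_cast hq0
  have hq1 : 1 < q := by
    by_contra hle
    have hle' : (q : ℝ) ≤ 1 := by exact_mod_cast not_lt.1 hle
    have := Real.log_nonpos hq0'.le hle'
    linarith
  -- the constants
  have hl2 := Real.log_two_lt_d9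
  have hlπ := bmor_log_pi_lt
  have hl3 := Real.log_three_gt_d9
  have hl3' := Real.log_three_lt_d9
  have hl115 := bmor_log_115_lt
  have hπ := Real.pi_lt_d4
  -- `ℓ ≥ 114`
  have hℓ : bmorEll q 1 = Real.log q + Real.log 3 - Real.log 2 - Real.log π := bmorEll_one hq0
  have hℓ114 : (114 : ℝ) ≤ bmorEll q 1 := by rw [hℓ]; linarith
  have hℓ1567 : (1.567 : ℝ) < bmorEll q 1 := by linarith
  -- Theorem 1.1 at `T = 1`, lower form
  have hlow := bmor2021_theorem11.main_sub_err_le h hq1 hχ (T := 1) (by norm_num) hℓ1567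
  rw [bmor_log_mainTerm_one hq0] at hlow
  -- concavity: `log(1 + ℓ) ≤ log 115 + ((1 + ℓ)/115 − 1)`
  have hlog1ℓ : Real.log (1 + bmorEll q 1) ≤ 3.8 + (1 + bmorEll q 1) / 115 := by
    have hpos : 0 < (1 + bmorEll q 1) / 115 := by positivity
    have h1 := Real.log_le_sub_one_of_pos hpos
    rw [Real.log_div (by linarith) (by norm_num)] at h1
    linarith
  -- the main term: `(log q − log 2 − log π − 1)/π = (ℓ − log 3 − 1)/π ≥ 0.3183 (ℓ − 2.099)`
  -- (`1/π > 1/3.1416 > 0.3183`; `linarith` does not see through a decimal denominator, so the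
  -- reciprocal is taken by hand)
  have hinv : (0.3183 : ℝ) ≤ 1 / π := by
    rw [le_div_iff₀ Real.pi_pos]; nlinarith
  have hmain : 0.3183 * (bmorEll q 1 - 2.099) ≤
      1 / π * (Real.log q - Real.log 2 - Real.log π - 1) := by
    have hnum : Real.log q - Real.log 2 - Real.log π - 1 = bmorEll q 1 - Real.log 3 - 1 := by
      rw [hℓ]; ring
    rw [hnum]
    have h0 : 0 ≤ bmorEll q 1 - Real.log 3 - 1 := by linarith
    calc 0.3183 * (bmorEll q 1 - 2.099) ≤ 0.3183 * (bmorEll q 1 - Real.log 3 - 1) := by nlinarith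
      _ ≤ 1 / π * (bmorEll q 1 - Real.log 3 - 1) := mul_le_mul_of_nonneg_right hinv h0
  have hsign := bmor_neg_one_pow_div_four_le (charParity χ)
  -- assemble: `0 < N(1, χ)` as a real number
  have hpos : (0 : ℝ) < (lfunctionZeroCount χ 1 : ℝ) := by linarith
  exact Nat.one_le_iff_ne_zero.2 (by rintro h0; simp [h0] at hpos)

omit [NeZero q] in
/-- `q ≥ 10⁵⁰ ⟹ log q ≥ 115` (`log 10 ≥ 2.3`). [folklore] -/
private theorem log_ge_of_ten_pow_fifty_le (hq : 10 ^ 50 ≤ q) : (115 : ℝ) ≤ Real.log q := by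
  have hq' : (10 : ℝ) ^ 50 ≤ q := by exact_mod_cast hq
  have h := Real.log_le_log (by positivity) hq'
  rw [Real.log_pow] at h
  push_cast at h
  linarith [bmor_log_ten_ge]

/-- **Every primitive Dirichlet `L`-function of conductor `q ≥ 10⁵⁰` has a zero `ρ` with `0 < Re ρ < 1` and
`|Im ρ| ≤ 1`** — unconditionally, given Theorem 1.1 of Bennett–Martin–O'Bryant–Rechnitzer (their remark,
p. 3: `N(1, χ) ≥ 1` for `q ≥ 1.3 × 10⁴⁷`; threshold `10⁵⁰` as proved in
`one_le_lfunctionZeroCount_one_of_bmor`). A positive count over the box `lfunctionZeroBox χ 1` means the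
box is non-empty. [cite: BennettMartinOBryantRechnitzer2021, Theorem 1.1 and p. 3] -/
theorem exists_lfunctionZero_abs_im_le_one_of_bmor (h : bmor2021_theorem11) (hq : 10 ^ 50 ≤ q)
    (χ : DirichletCharacter ℂ q) (hχ : χ.IsPrimitive) :
    ∃ ρ : ℂ, χ.LFunction ρ = 0 ∧ 0 < ρ.re ∧ ρ.re < 1 ∧ |ρ.im| ≤ 1 := by
  have h1 := one_le_lfunctionZeroCount_one_of_bmor h (log_ge_of_ten_pow_fifty_le hq) χ hχ
  by_contra hne
  push Not at hne
  have hempty : lfunctionZeroBox χ 1 = ∅ := by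
    ext ρ
    simp only [mem_lfunctionZeroBox, Set.mem_empty_iff_false, iff_false, not_and, not_le]
    exact hne ρ
  have h0 : lfunctionZeroCount χ 1 = 0 := by
    unfold lfunctionZeroCount
    rw [hempty, finsum_mem_empty]
  omega

/-! ### The zero-free clause `ℓ ≤ 1.567 ⟹ N(T, χ) = 0` and the conductor-`3` champion

The first clause of Theorem 1.1 is, in print, Lemma 6.1 (b) (p. 19): read off the authors' rigorous zeros
(known "to within `10⁻¹²`", §6.3) of the 40 primitive characters with `q ≤ 15` — "The conditions in
Lemma 6.1(b) imply that `q ≤ 15` … and for each, the lowest-height zero is excluded by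
`log(q(T+2)/2π) ≤ 1.567`" (p. 20). The binding character is `(−3/·)`: `ℓ(3, γ₁) = 1.56728…` at its lowest
zero `γ₁ = 8.0397…`, so `1.567` is that number truncated to three decimals, and at conductor `3` the clause
is non-vacuous up to `T = 2π e^{1.567}/3 − 2 = 8.0368…`. Consequence proved here: **every zero `ρ` of
`L(s, (−3/·))` with `0 < Re ρ < 1` has `|Im ρ| > 8`** (unconditionally, given Theorem 1.1) — the "highest"
half of the statement "among primitive Dirichlet characters of conductor `q ≥ 3`, `(−3/·)` has the highest
lowest zero". -/

/-- Zero-free clause of Theorem 1.1: for `q > 1`, `χ` primitive, `T ≥ 5/7` and `ℓ(q, T) ≤ 1.567`,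
`N(T, χ) = 0` (in print also Lemma 6.1 (b), from the rigorous zeros of the 40 primitive characters with
`q ≤ 15`). [cite: BennettMartinOBryantRechnitzer2021, Theorem 1.1 and Lemma 6.1 (b)] -/
theorem bmor2021_theorem11.zeroCount_eq_zero (h : bmor2021_theorem11) (hq : 1 < q) (hχ : χ.IsPrimitive)
    {T : ℝ} (hT : 5 / 7 ≤ T) (hℓ : bmorEll q T ≤ 1.567) : lfunctionZeroCount χ T = 0 :=
  (h q hq χ hχ T hT).1 hℓ

/-- Zero-level form of the zero-free clause: for `q > 1`, `χ` primitive, `T ≥ 5/7`, `ℓ(q, T) ≤ 1.567`,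
EVERY zero `ρ` of `L(s, χ)` with `0 < Re ρ < 1` has `|Im ρ| > T`. (The box `lfunctionZeroBox χ T` is finite
for `χ ≠ χ₀` (`lfunctionZeroBox_finite`) and each of its points has positive multiplicity
(`DirichletDisc.zeroOrder_pos_iff`), so a vanishing count `N(T, χ)` empties it.)
[cite: BennettMartinOBryantRechnitzer2021, Theorem 1.1] -/
theorem bmor2021_theorem11.lt_abs_im_of_zero (h : bmor2021_theorem11) (hq : 1 < q)
    (hχ : χ.IsPrimitive) {T : ℝ} (hT : 5 / 7 ≤ T) (hℓ : bmorEll q T ≤ 1.567) {ρ : ℂ}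
    (hρ : χ.LFunction ρ = 0) (h0 : 0 < ρ.re) (h1 : ρ.re < 1) : T < |ρ.im| := by
  have hne : χ ≠ 1 := by
    intro h1'
    rw [h1', DirichletCharacter.IsPrimitive, DirichletCharacter.conductor_one] at hχ
    omega
  by_contra hle
  push Not at hle
  have hmem : ρ ∈ lfunctionZeroBox χ T := mem_lfunctionZeroBox.2 ⟨hρ, h0, h1, hle⟩
  have hfin : (lfunctionZeroBox χ T).Finite := lfunctionZeroBox_finite hne T
  have hpos : 0 < DirichletDisc.zeroOrder χ ρ := (DirichletDisc.zeroOrder_pos_iff χ hne ρ).2 hρ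
  have hcount : 0 < lfunctionZeroCount χ T := by
    unfold lfunctionZeroCount
    rw [finsum_mem_eq_finite_toFinset_sum _ hfin]
    exact Finset.sum_pos' (fun _ _ ↦ Nat.zero_le _) ⟨ρ, (hfin.mem_toFinset).2 hmem, hpos⟩
  have h0' := bmor2021_theorem11.zeroCount_eq_zero h hq hχ hT hℓ
  omega

omit [NeZero q] in
/-- `ℓ(3, T) ≤ 1.567` for `−2 < T ≤ 8`: `ℓ(3, T) ≤ ℓ(3, 8) = log(15/π) = log 5 − log(π/3)` with
`log(π/3) ≥ 1 − 3/π > 0.045` (`π > 3.141592`) and Mathlib's `log 5 < 1.6094379126`, so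
`ℓ(3, 8) < 1.5645` (true value `1.56332…`; the printed `1.567` is `ℓ(3, 8.0397…)` truncated).
[cite: BennettMartinOBryantRechnitzer2021, Theorem 1.1 and Lemma 6.1 (b)] -/
theorem bmorEll_three_le {T : ℝ} (hT0 : -2 < T) (hT : T ≤ 8) : bmorEll 3 T ≤ 1.567 := by
  show Real.log ((3 : ℕ) * (T + 2) / (2 * π)) ≤ 1.567
  push_cast
  have hπ := Real.pi_gt_d6
  have hT2 : 0 < T + 2 := by linarith
  have hpos : (0 : ℝ) < 3 * (T + 2) / (2 * π) := div_pos (by positivity) (by positivity)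
  have h15 : (3 : ℝ) * (T + 2) / (2 * π) ≤ 15 / π := by
    rw [div_le_div_iff₀ (by positivity) Real.pi_pos]
    nlinarith [Real.pi_pos]
  have hlog : Real.log (15 / π) = Real.log 5 - Real.log (π / 3) := by
    rw [Real.log_div (by norm_num) Real.pi_pos.ne', Real.log_div Real.pi_pos.ne' (by norm_num),
      show (15 : ℝ) = 5 * 3 by norm_num, Real.log_mul (by norm_num) (by norm_num)]
    ring
  have h1 : 1 - (π / 3)⁻¹ ≤ Real.log (π / 3) := Real.one_sub_inv_le_log_of_pos (by positivity)
  have h2 : (π / 3)⁻¹ < 0.955 := by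
    rw [inv_div, div_lt_iff₀ Real.pi_pos]
    nlinarith
  calc Real.log (3 * (T + 2) / (2 * π)) ≤ Real.log (15 / π) := Real.log_le_log hpos h15
    _ ≤ 1.567 := by rw [hlog]; linarith [Real.log_five_lt_d9]

/-- A non-principal Dirichlet character modulo the prime `3` is primitive (its conductor divides `3` and
is not `1`). [folklore] -/
private theorem bmor_isPrimitive_mod_three_of_ne_one {χ : DirichletCharacter ℂ 3} (hχ : χ ≠ 1) :
    χ.IsPrimitive := by
  rw [DirichletCharacter.isPrimitive_def]
  rcases (Nat.dvd_prime Nat.prime_three).mp (DirichletCharacter.conductor_dvd_level χ) with h3 | h3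
  · exact absurd (DirichletCharacter.eq_one_iff_conductor_eq_one.mpr h3) hχ
  · exact h3

/-- **`N(T, χ) = 0` for the non-principal character modulo `3` and every `5/7 ≤ T ≤ 8`**: Theorem 1.1's
zero-free clause at conductor `3` (`ℓ(3, T) ≤ ℓ(3, 8) < 1.5645 ≤ 1.567`; the only non-principal
character mod `3` is `(−3/·)`, primitive). [cite: BennettMartinOBryantRechnitzer2021, Theorem 1.1 and Lemma 6.1 (b)] -/
theorem lfunctionZeroCount_mod_three_eq_zero_of_bmor (h : bmor2021_theorem11)
    (χ : DirichletCharacter ℂ 3) (hχ : χ ≠ 1) {T : ℝ} (hT : 5 / 7 ≤ T) (hT8 : T ≤ 8) :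
    lfunctionZeroCount χ T = 0 :=
  bmor2021_theorem11.zeroCount_eq_zero h (by norm_num) (bmor_isPrimitive_mod_three_of_ne_one hχ) hT
    (bmorEll_three_le (by linarith) hT8)

/-- ★ **The lowest zero of `L(s, (−3/·))` lies above height `8`**: given Theorem 1.1 of
Bennett–Martin–O'Bryant–Rechnitzer, every zero `ρ` of `L(s, χ)`, `χ` the non-principal character modulo
`3`, with `0 < Re ρ < 1` satisfies `|Im ρ| > 8` — unconditionally (no GRH). In print the excluded range is
`|Im ρ| ≤ 8.0368…` (`ℓ(3, T) ≤ 1.567`), calibrated on the rigorous value `γ₁ = 8.0397…` of Lemma 6.1's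
data set; `8` is what is proved here. This is the "highest" half of "(−3/·) has the highest lowest zero
among primitive Dirichlet characters of conductor `≥ 3`"; the other half (every other such `L(s, χ)` has
a zero of height `≤ 8`) is a GRH-conditional statement not in this file.
[cite: BennettMartinOBryantRechnitzer2021, Theorem 1.1 and Lemma 6.1 (b)] -/
theorem eight_lt_abs_im_of_lfunctionZero_mod_three_of_bmor (h : bmor2021_theorem11)
    (χ : DirichletCharacter ℂ 3) (hχ : χ ≠ 1) {ρ : ℂ} (hρ : χ.LFunction ρ = 0) (h0 : 0 < ρ.re)
    (h1 : ρ.re < 1) : 8 < |ρ.im| :=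
  bmor2021_theorem11.lt_abs_im_of_zero h (by norm_num) (bmor_isPrimitive_mod_three_of_ne_one hχ)
    (by norm_num) (bmorEll_three_le (by norm_num) le_rfl) hρ h0 h1

/-- The same in box language: `lfunctionZeroBox χ 8 = ∅` for the non-principal character modulo `3`.
[cite: BennettMartinOBryantRechnitzer2021, Theorem 1.1 and Lemma 6.1 (b)] -/
theorem lfunctionZeroBox_mod_three_eight_eq_empty_of_bmor (h : bmor2021_theorem11)
    (χ : DirichletCharacter ℂ 3) (hχ : χ ≠ 1) : lfunctionZeroBox χ 8 = ∅ := by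
  ext ρ
  simp only [mem_lfunctionZeroBox, Set.mem_empty_iff_false, iff_false, not_and, not_le]
  exact fun hρ h0 h1 ↦ eight_lt_abs_im_of_lfunctionZero_mod_three_of_bmor h χ hχ hρ h0 h1

end Literature.NumberTheory.LFunctions
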